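import Literature.NumberTheory.EllipticCurves.ManinConstantLegendreTwistProofs
import HarnessLib

/-!
# `‖u‖_p ≤ 1` at a potentially multiplicative additive prime and at the additive prime `3`, for an abstract
# formal-parameter package (lattice-free twins of the tree's `ManinConstantPotMultiplicativeProofs` §PotMult,
# `FormalMulThreeHeightDichotomyProofs` good-twist ender and `ManinConstantLegendreTwistProofs` §Three)
# (route `ManinLocalTwoThree`, cruxes C2 stmt-BirchSwinnertonDyer-22967 / C3 stmt-…-22968; cell bsd-f2-manin, prover p2 gen 25;
# CES-discharge programme, stage 3 step (3b))

The tree proves `‖q‖_p ≤ 1` for the data of the fact `edixhoven_int_of_neronLattice_eq_smul_periodLattice`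
(`Λ_{L'} = q·Λ₀(f)`) at a potentially multiplicative additive prime (`…_of_one_lt_norm_j`, `_two`, `_three`) and at an
additive `3` of potentially good reduction (`…_of_goodTwist_three`, `…_of_norm_j_le_one_three`) by feeding explicit
semistable twists (`exists_nodalTwist_of_one_lt_norm_j`, `exists_legendreTwist_of_norm_j_le_one`) to the ABSTRACT local
core `padicNorm_le_one_of_formalLog_subst_eq_of_semistableTwist_sharp`, through the lattice wrapper
`…_of_semistableTwist_sharp`, whose only use of the lattice is the formal parameter `t₀` of `W'`
(`exists_formalParam_of_neronLattice_eq_smul_periodLattice`).  THIS FILE states the same theorems for an ABSTRACT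
formal-parameter package (`u > 0`, `t₀ ∈ qℚ⟦q⟧`, `[X¹]t₀ = u`, `log_{W'}(t₀) = u·Σ aₙ(W')qⁿ/n`, `t₀, w_{W'}(t₀) ∈ Frac ℤ⟦q⟧`),
calling the abstract core directly — so that they apply to the `X₁(N)`-parametrisation of the Stevens curve
(`…StevensShortModelParam`):

* `padicNorm_le_one_of_formalParam_of_one_lt_norm_j` (+ `_two`, `_three`): potentially multiplicative additive `p`;
* `padicNorm_le_one_of_formalParam_of_goodTwist_three`, `…_of_norm_j_le_one_three`, `…_of_additive_three`:
  the additive prime `3`.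

Proofs: the tree's, verbatim, with the lattice wrapper replaced by the abstract core (Honda witness and `p`-integrality
of `Σ aₙXⁿ/n` are free at an additive prime: `exists_padicInt_formalLog_subst_eq_lSeriesLog_of_dvd_of_dvd`,
`norm_coeff_lSeriesLog_le_one_of_dvd_of_dvd`).  Fact-free; standard axioms; no definitions.  BSD is not proved by
this file; Manin's conjecture, C2 and C3 are not proved by this file.
[cite: EdixhovenManin1991, Prop. 2] [cite: Honda1970, Thm. 2 (p. 223)] [cite: SilvermanAEC2009, Prop. III.1.4(c), IV.7.5,
VII.5.4, VII.5.5, Ex. 7.1]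
-/

set_option autoImplicit false
-- lint-debt: the directory name repeats the summit name (sibling precedent `ManinLocalTwoThreeStevensCurveDatum.lean`)
set_option linter.dupNamespace false

noncomputable section

open scoped Classical IntermediateField

open PowerSeries Literature.RingTheory.FormalGroups Literature.NumberTheory.EllipticCurves
open Literature.NumberTheory.EllipticCurves.ModularForms Literature.NumberTheory.Automorphic
open Literature.NumberTheory.GaloisRepresentations IsLocalRing
open _root_.WeierstrassCurve

namespace Summit.BirchSwinnertonDyer.BirchSwinnertonDyer.Theorems.ManinLocalTwoThree.StevensIntegrality

/-! ## §1 Potentially multiplicative additive primes -/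

/-- **`‖u‖_p ≤ 1` at a potentially multiplicative additive prime**, for an abstract formal parameter: `p ∣ Δ_min(W')`,
`p ∣ c₄(W')`, `‖j(W')‖_p > 1`, `‖c₄(W')‖_p = p⁻ⁿ` with `(p − 1)n < 4p`.  The nodal twist
`exists_nodalTwist_of_one_lt_norm_j` (`J = p`, `4k = ne`) fed to the abstract sharp core. [cite: EdixhovenManin1991, Prop. 2]
[cite: SilvermanAEC2009, Prop. III.1.4(c), VII.5.5] -/
theorem padicNorm_le_one_of_formalParam_of_one_lt_norm_j
    (W' : WeierstrassCurve ℚ) [W'.IsElliptic] [W'.IsGloballyMinimal]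
    {u : ℚ} (hCpos : 0 < u) {t₀ : ℚ⟦X⟧} (ht₀0 : constantCoeff t₀ = 0) (ht₀1 : coeff 1 t₀ = u)
    (hlog₀ : W'.formalLog.subst t₀ = C u * PowerSeries.mk fun n ↦ ((W'.LFunction n : ℤ) : ℚ) / n)
    {P' Q' P₂' Q₂' : ℤ⟦X⟧} (hQ' : Q' ≠ 0)
    (hPQ' : t₀ * Q'.map (Int.castRingHom ℚ) = P'.map (Int.castRingHom ℚ)) (hQ₂' : Q₂' ≠ 0)
    (hPQ₂' : W'.formalW.subst t₀ * Q₂'.map (Int.castRingHom ℚ) = P₂'.map (Int.castRingHom ℚ))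
    {p : ℕ} [hp : Fact p.Prime] (hΔ : (p : ℤ) ∣ minimalDiscriminantInt W')
    (hc₄ : (p : ℤ) ∣ (integralModelInt W').c₄) (hj : 1 < ‖((W'.j : ℚ) : ℚ_[p])‖) {n : ℕ}
    (hn : ‖((W'.c₄ : ℚ) : ℚ_[p])‖ = ((p : ℝ)⁻¹) ^ n) (hnp : (p - 1) * n < 4 * p) :
    ‖((u : ℚ) : ℚ_[p])‖ ≤ 1 := by
  obtain ⟨K, hK, πu, e, k, r, s, t, V'', hπe, he, hke, hV'', hunit⟩ :=
    exists_nodalTwist_of_one_lt_norm_j W' hj hn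
  haveI := hK
  refine padicNorm_le_one_of_formalLog_subst_eq_of_semistableTwist_sharp W' hCpos ht₀0 ht₀1 hlog₀ hQ' hPQ' hQ₂'
    hPQ₂' (W'.exists_padicInt_formalLog_subst_eq_lSeriesLog_of_dvd_of_dvd hΔ hc₄)
    (W'.norm_coeff_lSeriesLog_le_one_of_dvd_of_dvd p hΔ hc₄) K πu hπe r s t V'' hV'' ⟨p, hp.out.pos, hunit, ?_⟩
  -- `(p − 1)k < pe` from `4k = ne` and `(p − 1)n < 4p`
  have h4 : 4 * ((p - 1) * k) < 4 * (p * e) := by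
    calc 4 * ((p - 1) * k) = (p - 1) * (4 * k) := by ring
      _ = (p - 1) * n * e := by rw [hke]; ring
      _ < 4 * p * e := Nat.mul_lt_mul_of_pos_right hnp he
      _ = 4 * (p * e) := by ring
  exact Nat.lt_of_mul_lt_mul_left h4

/-- **`‖u‖₂ ≤ 1` at a potentially multiplicative additive prime `2`** (`v₂(j) < 0`), for an abstract formal parameter:
`v₂(c₄) < 8` is automatic by Kraus (`not_pow_dvd_c₄_minimalDiscriminantInt_two`). [cite: EdixhovenManin1991, Prop. 2]
[cite: SilvermanAEC2009, Prop. VII.5.5, Ex. 7.1] -/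
theorem padicNorm_le_one_of_formalParam_of_one_lt_norm_j_two
    (W' : WeierstrassCurve ℚ) [W'.IsElliptic] [W'.IsGloballyMinimal]
    {u : ℚ} (hCpos : 0 < u) {t₀ : ℚ⟦X⟧} (ht₀0 : constantCoeff t₀ = 0) (ht₀1 : coeff 1 t₀ = u)
    (hlog₀ : W'.formalLog.subst t₀ = C u * PowerSeries.mk fun n ↦ ((W'.LFunction n : ℤ) : ℚ) / n)
    {P' Q' P₂' Q₂' : ℤ⟦X⟧} (hQ' : Q' ≠ 0)
    (hPQ' : t₀ * Q'.map (Int.castRingHom ℚ) = P'.map (Int.castRingHom ℚ)) (hQ₂' : Q₂' ≠ 0)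
    (hPQ₂' : W'.formalW.subst t₀ * Q₂'.map (Int.castRingHom ℚ) = P₂'.map (Int.castRingHom ℚ))
    (hΔ : (2 : ℤ) ∣ minimalDiscriminantInt W') (hc₄ : (2 : ℤ) ∣ (integralModelInt W').c₄)
    (hj : 1 < ‖((W'.j : ℚ) : ℚ_[2])‖) : ‖((u : ℚ) : ℚ_[2])‖ ≤ 1 := by
  haveI : Fact (Nat.Prime 2) := ⟨Nat.prime_two⟩
  have hc₄0 : (integralModelInt W').c₄ ≠ 0 := by
    intro h0
    have h := norm_minimalDiscriminantInt_lt_of_one_lt_norm_j W' (p := 2) hj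
    rw [c₄_eq_intCast_c₄_integralModelInt, h0] at h
    simp only [Int.cast_zero, Rat.cast_zero, norm_zero, ne_eq, OfNat.ofNat_ne_zero,
      not_false_eq_true, zero_pow] at h
    exact absurd h (not_lt.mpr (norm_nonneg _))
  set n := padicValInt 2 (integralModelInt W').c₄ with hn_def
  have hn := norm_c₄_eq_inv_pow_padicValInt W' (p := 2) hc₄0
  refine padicNorm_le_one_of_formalParam_of_one_lt_norm_j W' hCpos ht₀0 ht₀1 hlog₀ hQ' hPQ' hQ₂' hPQ₂'
    (p := 2) (by exact_mod_cast hΔ) (by exact_mod_cast hc₄) hj hn ?_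
  -- `n < 8`
  by_contra hcon
  have hn8 : 8 ≤ n := by omega
  apply not_pow_dvd_c₄_minimalDiscriminantInt_two W'
  refine ⟨(padicValInt_dvd_iff 8 _).mpr (Or.inr hn8), ?_⟩
  have hlt := norm_minimalDiscriminantInt_lt_of_one_lt_norm_j W' (p := 2) hj
  rw [hn, ← pow_mul] at hlt
  have hle : ‖((minimalDiscriminantInt W' : ℤ) : ℚ_[2])‖ ≤ ((2 : ℕ) : ℝ) ^ (-(16 : ℕ) : ℤ) := by
    rw [zpow_neg, zpow_natCast, ← inv_pow]
    have h' : ‖((minimalDiscriminantInt W' : ℚ) : ℚ_[2])‖ =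
        ‖((minimalDiscriminantInt W' : ℤ) : ℚ_[2])‖ := by push_cast; rfl
    rw [← h']
    refine hlt.le.trans (pow_le_pow_of_le_one (by positivity) ?_ (by omega))
    exact inv_le_one_of_one_le₀ (by norm_num)
  exact_mod_cast (Padic.norm_int_le_pow_iff_dvd _ 16).mp hle

/-- **`‖u‖₃ ≤ 1` at a potentially multiplicative additive prime `3`** (type `Iₙ*`, `n ≥ 1`), for an abstract formal
parameter: `2·v₃(c₄) < 12` by Kraus (`not_pow_dvd_c₄_minimalDiscriminantInt_three`). [cite: EdixhovenManin1991, Prop. 2]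
[cite: SilvermanAEC2009, Prop. VII.5.5, Ex. 7.1] -/
theorem padicNorm_le_one_of_formalParam_of_one_lt_norm_j_three
    (W' : WeierstrassCurve ℚ) [W'.IsElliptic] [W'.IsGloballyMinimal]
    {u : ℚ} (hCpos : 0 < u) {t₀ : ℚ⟦X⟧} (ht₀0 : constantCoeff t₀ = 0) (ht₀1 : coeff 1 t₀ = u)
    (hlog₀ : W'.formalLog.subst t₀ = C u * PowerSeries.mk fun n ↦ ((W'.LFunction n : ℤ) : ℚ) / n)
    {P' Q' P₂' Q₂' : ℤ⟦X⟧} (hQ' : Q' ≠ 0)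
    (hPQ' : t₀ * Q'.map (Int.castRingHom ℚ) = P'.map (Int.castRingHom ℚ)) (hQ₂' : Q₂' ≠ 0)
    (hPQ₂' : W'.formalW.subst t₀ * Q₂'.map (Int.castRingHom ℚ) = P₂'.map (Int.castRingHom ℚ))
    (hΔ : (3 : ℤ) ∣ minimalDiscriminantInt W') (hc₄ : (3 : ℤ) ∣ (integralModelInt W').c₄)
    (hj : 1 < ‖((W'.j : ℚ) : ℚ_[3])‖) : ‖((u : ℚ) : ℚ_[3])‖ ≤ 1 := by
  haveI : Fact (Nat.Prime 3) := ⟨Nat.prime_three⟩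
  have hc₄0 : (integralModelInt W').c₄ ≠ 0 := by
    intro h0
    have h := norm_minimalDiscriminantInt_lt_of_one_lt_norm_j W' (p := 3) hj
    rw [c₄_eq_intCast_c₄_integralModelInt, h0] at h
    simp only [Int.cast_zero, Rat.cast_zero, norm_zero, ne_eq, OfNat.ofNat_ne_zero,
      not_false_eq_true, zero_pow] at h
    exact absurd h (not_lt.mpr (norm_nonneg _))
  set n := padicValInt 3 (integralModelInt W').c₄ with hn_def
  have hn := norm_c₄_eq_inv_pow_padicValInt W' (p := 3) hc₄0
  refine padicNorm_le_one_of_formalParam_of_one_lt_norm_j W' hCpos ht₀0 ht₀1 hlog₀ hQ' hPQ' hQ₂' hPQ₂'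
    (p := 3) (by exact_mod_cast hΔ) (by exact_mod_cast hc₄) hj hn ?_
  -- `2n < 12`
  by_contra hcon
  have hn6 : 6 ≤ n := by omega
  apply not_pow_dvd_c₄_minimalDiscriminantInt_three W'
  refine ⟨(padicValInt_dvd_iff 5 _).mpr (Or.inr ((by norm_num : (5 : ℕ) ≤ 6).trans hn6)), ?_⟩
  have hlt := norm_minimalDiscriminantInt_lt_of_one_lt_norm_j W' (p := 3) hj
  rw [hn, ← pow_mul] at hlt
  have hle : ‖((minimalDiscriminantInt W' : ℤ) : ℚ_[3])‖ ≤ ((3 : ℕ) : ℝ) ^ (-(14 : ℕ) : ℤ) := by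
    rw [zpow_neg, zpow_natCast, ← inv_pow]
    have h' : ‖((minimalDiscriminantInt W' : ℚ) : ℚ_[3])‖ =
        ‖((minimalDiscriminantInt W' : ℤ) : ℚ_[3])‖ := by push_cast; rfl
    rw [← h']
    refine hlt.le.trans (pow_le_pow_of_le_one (by positivity) ?_ (by omega))
    exact inv_le_one_of_one_le₀ (by norm_num)
  exact_mod_cast (Padic.norm_int_le_pow_iff_dvd _ 14).mp hle

/-! ## §2 The additive prime `3` -/

/-- **`‖u‖₃ ≤ 1` from a twist with good reduction and `8k < 9e`**, for an abstract formal parameter (the tree's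
`…_of_goodTwist_three`: height dichotomy `isUnit_coeff_formalMul_three_or` and the abstract sharp core).
[cite: EdixhovenManin1991, Prop. 2] [cite: SilvermanAEC2009, IV.7.5, VII.5.4] -/
theorem padicNorm_le_one_of_formalParam_of_goodTwist_three
    (W' : WeierstrassCurve ℚ) [W'.IsElliptic] [W'.IsGloballyMinimal]
    {u : ℚ} (hCpos : 0 < u) {t₀ : ℚ⟦X⟧} (ht₀0 : constantCoeff t₀ = 0) (ht₀1 : coeff 1 t₀ = u)
    (hlog₀ : W'.formalLog.subst t₀ = C u * PowerSeries.mk fun n ↦ ((W'.LFunction n : ℤ) : ℚ) / n)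
    {P' Q' P₂' Q₂' : ℤ⟦X⟧} (hQ' : Q' ≠ 0)
    (hPQ' : t₀ * Q'.map (Int.castRingHom ℚ) = P'.map (Int.castRingHom ℚ)) (hQ₂' : Q₂' ≠ 0)
    (hPQ₂' : W'.formalW.subst t₀ * Q₂'.map (Int.castRingHom ℚ) = P₂'.map (Int.castRingHom ℚ))
    [hp : Fact (Nat.Prime 3)]
    (hΔ : (3 : ℤ) ∣ minimalDiscriminantInt W') (hc₄ : (3 : ℤ) ∣ (integralModelInt W').c₄)
    (K : IntermediateField ℚ_[3] (PadicAlgCl 3)) [FiniteDimensional ℚ_[3] K] (πu : Kˣ) {e k : ℕ}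
    (hπe : ‖((πu : K) : PadicAlgCl 3)‖ ^ e = (3 : ℝ)⁻¹) (r s t : padicCoeffRing K)
    (V'' : WeierstrassCurve (padicCoeffRing K))
    (hV'' : V''.map (algebraMap (padicCoeffRing K) K) =
      (⟨πu ^ k, (r : K), (s : K), (t : K)⟩ : VariableChange K) • W'.map (algebraMap ℚ K))
    (hgood : IsUnit V''.Δ) (hke : 8 * k < 9 * e) : ‖((u : ℚ) : ℚ_[3])‖ ≤ 1 := by
  letI hOloc : IsLocalRing (padicCoeffRing K) := isLocalRing_padicCoeffRing K
  letI hOch : CharP (ResidueField (padicCoeffRing K)) 3 := charP_residueField_padicCoeffRing K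
  set Vr := V''.map (residue (padicCoeffRing K)) with hVr
  have hΔr : Vr.Δ ≠ 0 := by
    rw [hVr, map_Δ]
    exact (residue_ne_zero_iff_isUnit _).mpr hgood
  have hΔ' : ((3 : ℕ) : ℤ) ∣ minimalDiscriminantInt W' := by exact_mod_cast hΔ
  have hc₄' : ((3 : ℕ) : ℤ) ∣ (integralModelInt W').c₄ := by exact_mod_cast hc₄
  rcases Vr.isUnit_coeff_formalMul_three_or hΔr with h3 | ⟨-, h9⟩
  · refine padicNorm_le_one_of_formalLog_subst_eq_of_semistableTwist_sharp W' hCpos ht₀0 ht₀1 hlog₀ hQ' hPQ'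
      hQ₂' hPQ₂' (W'.exists_padicInt_formalLog_subst_eq_lSeriesLog_of_dvd_of_dvd hΔ' hc₄')
      (W'.norm_coeff_lSeriesLog_le_one_of_dvd_of_dvd 3 hΔ' hc₄') K πu hπe r s t V'' hV''
      ⟨3, by norm_num, ?_, by omega⟩
    rw [← residue_ne_zero_iff_isUnit, ← PowerSeries.coeff_map, map_formalMul, ← hVr]
    exact h3.ne_zero
  · refine padicNorm_le_one_of_formalLog_subst_eq_of_semistableTwist_sharp W' hCpos ht₀0 ht₀1 hlog₀ hQ' hPQ'
      hQ₂' hPQ₂' (W'.exists_padicInt_formalLog_subst_eq_lSeriesLog_of_dvd_of_dvd hΔ' hc₄')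
      (W'.norm_coeff_lSeriesLog_le_one_of_dvd_of_dvd 3 hΔ' hc₄') K πu hπe r s t V'' hV''
      ⟨9, by norm_num, ?_, by omega⟩
    rw [← residue_ne_zero_iff_isUnit, ← PowerSeries.coeff_map, map_formalMul, ← hVr]
    exact h9.ne_zero

/-- **`‖u‖₃ ≤ 1` at an additive prime `3` of potentially good reduction** (`‖j‖₃ ≤ 1`), for an abstract formal parameter:
the Legendre twist (`exists_legendreTwist_of_norm_j_le_one`, `12k = e·v₃(Δ_min)`), the Kraus bound `v₃(Δ_min) ≤ 13`, hence
`8k < 9e`, and the good-twist ender. [cite: EdixhovenManin1991, Prop. 2] [cite: SilvermanAEC2009, VII.5.4, VII.5.5, Ex. 7.1] -/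
theorem padicNorm_le_one_of_formalParam_of_norm_j_le_one_three
    (W' : WeierstrassCurve ℚ) [W'.IsElliptic] [W'.IsGloballyMinimal]
    {u : ℚ} (hCpos : 0 < u) {t₀ : ℚ⟦X⟧} (ht₀0 : constantCoeff t₀ = 0) (ht₀1 : coeff 1 t₀ = u)
    (hlog₀ : W'.formalLog.subst t₀ = C u * PowerSeries.mk fun n ↦ ((W'.LFunction n : ℤ) : ℚ) / n)
    {P' Q' P₂' Q₂' : ℤ⟦X⟧} (hQ' : Q' ≠ 0)
    (hPQ' : t₀ * Q'.map (Int.castRingHom ℚ) = P'.map (Int.castRingHom ℚ)) (hQ₂' : Q₂' ≠ 0)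
    (hPQ₂' : W'.formalW.subst t₀ * Q₂'.map (Int.castRingHom ℚ) = P₂'.map (Int.castRingHom ℚ))
    [hp : Fact (Nat.Prime 3)]
    (hΔ : (3 : ℤ) ∣ minimalDiscriminantInt W') (hc₄ : (3 : ℤ) ∣ (integralModelInt W').c₄)
    (hj : ‖((W'.j : ℚ) : ℚ_[3])‖ ≤ 1) : ‖((u : ℚ) : ℚ_[3])‖ ≤ 1 := by
  set v := padicValInt 3 (minimalDiscriminantInt W') with hv_def
  have hv := norm_Δ_eq_inv_pow_padicValInt W' (p := 3)
  obtain ⟨K, hK, πu, e, k, r, s, t, V'', hπe, he, hke, hV'', hunit⟩ :=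
    exists_legendreTwist_of_norm_j_le_one (p := 3) (by norm_num) W' hj hv
  haveI := hK
  refine padicNorm_le_one_of_formalParam_of_goodTwist_three W' hCpos ht₀0 ht₀1 hlog₀ hQ' hPQ' hQ₂' hPQ₂'
    hΔ hc₄ K πu hπe r s t V'' hV'' hunit ?_
  -- `v ≤ 13` by Kraus
  have hv13 : v ≤ 13 := by
    by_contra hcon
    have hv14 : 14 ≤ v := by omega
    apply not_pow_dvd_c₄_minimalDiscriminantInt_three W'
    refine ⟨?_, (padicValInt_dvd_iff 14 _).mpr (Or.inr hv14)⟩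
    have hjΔ : ((W'.j : ℚ) : ℚ_[3]) * ((W'.Δ : ℚ) : ℚ_[3]) = ((W'.c₄ : ℚ) : ℚ_[3]) ^ 3 := by
      exact_mod_cast WeierstrassCurve.j_mul_Δ_eq_c₄_pow W'
    have hn3 : ‖((W'.c₄ : ℚ) : ℚ_[3])‖ ^ 3 ≤ ((3 : ℝ)⁻¹) ^ 14 := by
      rw [← norm_pow, ← hjΔ, norm_mul, hv]
      calc ‖((W'.j : ℚ) : ℚ_[3])‖ * ((3 : ℕ) : ℝ)⁻¹ ^ v ≤ 1 * ((3 : ℕ) : ℝ)⁻¹ ^ v := by gcongr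
        _ = ((3 : ℕ) : ℝ)⁻¹ ^ v := one_mul _
        _ ≤ ((3 : ℕ) : ℝ)⁻¹ ^ 14 := pow_le_pow_of_le_one (by positivity)
            (inv_le_one_of_one_le₀ (by norm_num)) hv14
        _ = (3 : ℝ)⁻¹ ^ 14 := by norm_num
    by_cases hc₄0 : (integralModelInt W').c₄ = 0
    · rw [hc₄0]; exact dvd_zero _
    have hm := norm_c₄_eq_inv_pow_padicValInt W' (p := 3) hc₄0
    rw [hm, ← pow_mul] at hn3
    have h3m : 14 ≤ padicValInt 3 (integralModelInt W').c₄ * 3 := by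
      by_contra h'
      rw [not_le] at h'
      have hlt : ((3 : ℕ) : ℝ)⁻¹ ^ 14 < ((3 : ℕ) : ℝ)⁻¹ ^ (padicValInt 3 (integralModelInt W').c₄ * 3) :=
        (pow_lt_pow_iff_right_of_lt_one₀ (by positivity) (inv_lt_one_of_one_lt₀ (by norm_num))).mpr h'
      have : ((3 : ℕ) : ℝ)⁻¹ ^ 14 = (3 : ℝ)⁻¹ ^ 14 := by norm_num
      linarith
    refine (padicValInt_dvd_iff 5 _).mpr (Or.inr ?_)
    generalize padicValInt 3 (integralModelInt W').c₄ = m at h3m ⊢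
    omega
  -- `96k = 8ve ≤ 104e < 108e`
  have h1 : 8 * (12 * k) ≤ 8 * (13 * e) := by rw [hke]; exact Nat.mul_le_mul_left _ (Nat.mul_le_mul_right _ hv13)
  omega

/-- **`‖u‖₃ ≤ 1` at an ADDITIVE prime `3`, unconditionally**, for an abstract formal parameter (potentially good:
above; potentially multiplicative: `…_of_one_lt_norm_j_three`). [cite: EdixhovenManin1991, Prop. 2] -/
theorem padicNorm_le_one_of_formalParam_of_additive_three
    (W' : WeierstrassCurve ℚ) [W'.IsElliptic] [W'.IsGloballyMinimal]
    {u : ℚ} (hCpos : 0 < u) {t₀ : ℚ⟦X⟧} (ht₀0 : constantCoeff t₀ = 0) (ht₀1 : coeff 1 t₀ = u)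
    (hlog₀ : W'.formalLog.subst t₀ = C u * PowerSeries.mk fun n ↦ ((W'.LFunction n : ℤ) : ℚ) / n)
    {P' Q' P₂' Q₂' : ℤ⟦X⟧} (hQ' : Q' ≠ 0)
    (hPQ' : t₀ * Q'.map (Int.castRingHom ℚ) = P'.map (Int.castRingHom ℚ)) (hQ₂' : Q₂' ≠ 0)
    (hPQ₂' : W'.formalW.subst t₀ * Q₂'.map (Int.castRingHom ℚ) = P₂'.map (Int.castRingHom ℚ))
    [hp : Fact (Nat.Prime 3)]
    (hΔ : (3 : ℤ) ∣ minimalDiscriminantInt W') (hc₄ : (3 : ℤ) ∣ (integralModelInt W').c₄) :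
    ‖((u : ℚ) : ℚ_[3])‖ ≤ 1 := by
  rcases le_or_gt ‖((W'.j : ℚ) : ℚ_[3])‖ 1 with hj | hj
  · exact padicNorm_le_one_of_formalParam_of_norm_j_le_one_three W' hCpos ht₀0 ht₀1 hlog₀ hQ' hPQ' hQ₂' hPQ₂'
      hΔ hc₄ hj
  · exact padicNorm_le_one_of_formalParam_of_one_lt_norm_j_three W' hCpos ht₀0 ht₀1 hlog₀ hQ' hPQ' hQ₂' hPQ₂'
      hΔ hc₄ hj

end Summit.BirchSwinnertonDyer.BirchSwinnertonDyer.Theorems.ManinLocalTwoThree.StevensIntegrality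

end
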